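/-
Origin: expansion seat `planner-pub-hodgecm-pv01-0`, handover v2 2026-08-18 (`HOME/pub-hodgecm-pv01/lean/Pv01/GaloisB3Field.lean`, md5 2f88287c, 430 lines);
landed by the gen-6 packager in gate run 22 as `HodgeCM/PerL34/GaloisB3Field.lean` (import ^import Pv01\.→import HodgeCM.PerL34. ×1).
-/
/-
Origin: HOME/pub-hodgecm-pv01/lean/Pv01/GaloisB3Field.lean (module `Pv01.GaloisB3Field`; the packager renames to
`HodgeCM.PerL34.GaloisB3Field`) — session planner-pub-hodgecm-pv01-0 (unit pub-hodgecm-pv01, DAG-NODE PROVER #01).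
DAG node N03 (PerL v5 Lemma 2.1(b) "H' = H", ll. 153–156; §1.2 ll. 47–50).  ADDITIVE: the FIELD-THEORETIC form —
Galois groups and embeddings as in Mathlib, no permutation dictionary left.  Pure Mathlib + `Pv01.GaloisB3Abstract`.
-/
import Mathlib
import Summits.HodgeConjecture.HodgeCM.PerL34.GaloisB3Abstract

set_option autoImplicit false

/-!
# PerL Lemma 2.1(b) "`H' = H`" for actual fields

Data exactly as in PerL §1.2 (ll. 44–50): `L/ℚ` Galois (the Galois closure), `K ⊆ L` a subfield with `[K:ℚ] = 6`
whose normal closure is `L` (`IsNormalClosure ℚ K L`), `[L:ℚ] ∈ {24, 48}`, `𝒢 = Gal(L/ℚ) = L ≃ₐ[ℚ] L` acting on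
`Hom(K, ℂ) = Hom_ℚ(K, L)` (`K →ₐ[ℚ] L`; every embedding of `K` into `ℂ` lands in the normal field `L ⊂ ℂ`) by
post-composition, `c ∈ 𝒢` complex conjugation: a central involution with `c ∘ φ ≠ φ` for every embedding `φ` of
the CM field `K` (these three properties of `c` are the hypotheses `hcen`, `hc2`, `hfix` — PerL l. 47 "complex
conjugation `c ∈ 𝒢` is central"; `c ∘ φ = φ ∘ c_K ≠ φ` because `K` is totally imaginary), `φ₁ = ` the inclusion
`K.val`, `H = Gal(L/K) = K.fixingSubgroup`, a CM type `Φ_t ∋ φ₁` = `Φ : Finset (K →ₐ[ℚ] L)` with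
`φ ∈ Φ ↔ c ∘ φ ∉ Φ`, and `\widetilde Φ_t = {g ∈ 𝒢 : g|_K ∈ Φ_t} = {g : g ∘ φ₁ ∈ Φ}`.

* `embMulAction`, `emb_faithful` — the action is FAITHFUL (kernel: an automorphism fixing every conjugate
  embedding of `K` fixes `⨆ φ(K) = normalClosure ℚ K L = ⊤`).
* `card_emb` — `|Hom_ℚ(K, L)| = [K:ℚ]` (`AlgHom.card_of_splits`).
* `stabilizer_val_eq_fixingSubgroup` — `Stab_𝒢(φ₁) = Gal(L/K)`.
* `rightStab_eq_fixingSubgroup` — **L2.1(b): the right stabiliser `H'` of `\widetilde Φ_t` (A11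
  `RfwfReflex.rightStab`) equals `H = Gal(L/K)`; hence A11's `K' = L^{H'}` is `K`** — for `[L:ℚ] ∈ {24,48}`.
* `no_quadratic_subfield` — **§1.2 l. 49 "K contains no imaginary quadratic field"** (indeed no quadratic
  subfield at all): no intermediate field `E ≤ K` with `[L:E] · 2 = [L:ℚ]`.
* `card_gal_K` — **§1.2 l. 49 "|H| = 4 resp. 8"**.
* Section `CM`: for `L` a CM field (Mathlib `NumberField.IsCMField`) the three hypotheses on `c` are THEOREMS for
  `c := conjL = IsCMField.complexConj L`: `conjL_mul_conjL` (`c² = 1`), `conjL_central` (**PerL l. 47 "complex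
  conjugation is central"**, via `complexEmbedding_complexConj` under two embeddings), `conjL_smul_ne` (for `K`
  totally imaginary, `c ∘ φ ≠ φ`: else `φ(K) ⊆ L⁺` and `ψ ∘ φ` would be a real embedding of `K`); whence the
  hypothesis-free forms `rightStab_eq_gal` and `no_quadratic_subfield'` (instances: `IsCMField L`,
  `IsNormalClosure ℚ K L`, `IsTotallyComplex K`; numbers `[K:ℚ] = 6`, `[L:ℚ] ∈ {24,48}`), and
  `isGalois_of_isNormalClosure`.
* Section `Emb` + the primed lemmas of section `CM`: the SAME results in EMBEDDED form — `K` any number field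
  with its canonical `ℚ`-algebra structure, base point an embedding `ψ₀ : K →ₐ[ℚ] L` (PerL's `j : K ↪ L`),
  `H := Gal(L/ψ₀K) = ψ₀.fieldRange.fixingSubgroup`: `rightStab_eq_fixingSubgroup_emb`, `rightStab_eq_gal_emb`,
  `no_quadratic_subfield_emb(')`, `card_fixingSubgroup_emb` (|H| ∈ {4,8}). These are the forms instantiated on
  the package's bundled `CMField`s in `GaloisB3CM`.
No internal statement is cited and no hypothesis beyond Mathlib type-class data and the two degree conditions remains.
-/

namespace HodgeCM
namespace PerL34
namespace GaloisB3

open HodgeCM.Prior.ReflexLemma.RfwfReflex IntermediateField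

section Field

variable {L : Type*} [Field L] [NumberField L] (K : IntermediateField ℚ L)

/-- `Gal(L/ℚ)` acts on `Hom_ℚ(K, L)` by post-composition. -/
instance embMulAction : MulAction (L ≃ₐ[ℚ] L) (K →ₐ[ℚ] L) where
  smul g φ := (g : L →ₐ[ℚ] L).comp φ
  one_smul φ := by ext k; rfl
  mul_smul g h φ := by ext k; rfl

/-- (Ported verbatim from the HodgeCMPerL package; no docstring in the source.) -/
theorem emb_smul_apply (g : L ≃ₐ[ℚ] L) (φ : K →ₐ[ℚ] L) (k : K) : (g • φ) k = g (φ k) := rfl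

/-- (Ported verbatim from the HodgeCMPerL package; no docstring in the source.) -/
theorem emb_smul_def (g : L ≃ₐ[ℚ] L) (φ : K →ₐ[ℚ] L) : g • φ = (g : L →ₐ[ℚ] L).comp φ := rfl

/-- An automorphism of `L` composing trivially with every `ℚ`-embedding `K → L` is trivial, when `L` is the
normal closure of `K`. -/
theorem eq_one_of_comp_eq [IsNormalClosure ℚ K L] (m : L ≃ₐ[ℚ] L) (hm : ∀ φ : K →ₐ[ℚ] L, m • φ = φ) :
    m = 1 := by
  have htop : normalClosure ℚ K L = ⊤ :=
    ((Algebra.IsAlgebraic.isNormalClosure_iff).mp inferInstance).2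
  have hle : normalClosure ℚ K L ≤ fixedField (Subgroup.zpowers m) := by
    rw [normalClosure_le_iff]
    intro φ x hx
    obtain ⟨k, rfl⟩ := AlgHom.mem_fieldRange.mp hx
    rw [mem_fixedField_iff]
    intro g hg
    obtain ⟨j, rfl⟩ := Subgroup.mem_zpowers_iff.mp hg
    have hfixk : φ k ∈ MulAction.fixedBy L m := by
      show m • φ k = φ k
      rw [AlgEquiv.smul_def, ← emb_smul_apply K m φ k, hm φ]
    have := MulAction.fixedBy_subset_fixedBy_zpow L m j hfixk
    simpa [AlgEquiv.smul_def] using this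
  rw [htop, top_le_iff] at hle
  ext x
  have hx : x ∈ fixedField (Subgroup.zpowers m) := by rw [hle]; exact mem_top
  rw [mem_fixedField_iff] at hx
  exact hx m (Subgroup.mem_zpowers m)

/-- FAITHFULNESS of `Gal(L/ℚ)` on `Hom_ℚ(K, L)`. -/
instance emb_faithful [IsNormalClosure ℚ K L] : FaithfulSMul (L ≃ₐ[ℚ] L) (K →ₐ[ℚ] L) where
  eq_of_smul_eq_smul {g₁ g₂} h := by
    have key : g₂⁻¹ * g₁ = 1 := eq_one_of_comp_eq K _ fun φ => by
      rw [mul_smul, h φ, ← mul_smul, inv_mul_cancel, one_smul]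
    have := congrArg (g₂ * ·) key
    simpa [← mul_assoc] using this

/-- The base point `φ₁ = 1|_K`: the inclusion `K ⊆ L` as a `ℚ`-embedding. -/
def φ₁ : K →ₐ[ℚ] L := K.val

/-- (Ported verbatim from the HodgeCMPerL package; no docstring in the source.) -/
@[simp] theorem φ₁_apply (k : K) : φ₁ K k = (k : L) := rfl

/-- `|Hom_ℚ(K, L)| = [K:ℚ]`. -/
theorem card_emb [IsNormalClosure ℚ K L] : Fintype.card (K →ₐ[ℚ] L) = Module.finrank ℚ K :=
  AlgHom.card_of_splits ℚ K L (IsNormalClosure.splits (F := ℚ) (K := K) (L := L))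

/-- `Stab_𝒢(φ₁) = Gal(L/K)` for `φ₁ = K.val` the inclusion. -/
theorem stabilizer_val_eq_fixingSubgroup :
    MulAction.stabilizer (L ≃ₐ[ℚ] L) (φ₁ K) = K.fixingSubgroup := by
  ext g
  rw [MulAction.mem_stabilizer_iff, IntermediateField.mem_fixingSubgroup_iff]
  constructor
  · intro h x hx
    exact AlgHom.congr_fun h ⟨x, hx⟩
  · intro h
    apply AlgHom.ext
    intro k
    exact h k k.2

/-- **PerL Lemma 2.1(b), "`H' = H`" (hence `L^{H'} = K`), for fields.**  With `c` = complex conjugation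
(central involution moving every embedding of the CM field `K`) and `Φ ∋ φ₁` a CM type of `K` (read in `L`),
the right stabiliser of `\widetilde Φ = {g : g ∘ φ₁ ∈ Φ}` is `Gal(L/K)`, provided `[K:ℚ] = 6` and
`[L:ℚ] ∈ {24, 48}`. -/
theorem rightStab_eq_fixingSubgroup [IsGalois ℚ L] [IsNormalClosure ℚ K L]
    (hK : Module.finrank ℚ K = 6) (hL : Module.finrank ℚ L = 24 ∨ Module.finrank ℚ L = 48)
    (c : L ≃ₐ[ℚ] L) (hcen : ∀ g : L ≃ₐ[ℚ] L, c * g = g * c) (hc2 : c * c = 1)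
    (hfix : ∀ φ : K →ₐ[ℚ] L, c • φ ≠ φ)
    (Φ : Finset (K →ₐ[ℚ] L)) (hΦ : ∀ φ, φ ∈ Φ ↔ c • φ ∉ Φ) (h0 : φ₁ K ∈ Φ) :
    rightStab {g : L ≃ₐ[ℚ] L | g • φ₁ K ∈ Φ} = K.fixingSubgroup := by
  classical
  have hX : Fintype.card (K →ₐ[ℚ] L) = 6 := by rw [card_emb K, hK]
  have hcard : Nat.card (L ≃ₐ[ℚ] L) = 24 ∨ Nat.card (L ≃ₐ[ℚ] L) = 48 := by
    rwa [IsGalois.card_aut_eq_finrank]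
  rw [← stabilizer_val_eq_fixingSubgroup K]
  exact rightStab_pullback_eq_stabilizer hX hcard c hcen hc2 hfix Φ hΦ _ h0

/-- **"`K` contains no imaginary quadratic field"** (PerL §1.2 l. 49) — in fact no quadratic subfield: there is
no intermediate field `E ⊆ K` with `[Gal(L/E)] · 2 = |Gal(L/ℚ)|`, i.e. `[E:ℚ] = 2`. -/
theorem no_quadratic_subfield [IsGalois ℚ L] [IsNormalClosure ℚ K L]
    (hK : Module.finrank ℚ K = 6) (hL : Module.finrank ℚ L = 24 ∨ Module.finrank ℚ L = 48)
    (c : L ≃ₐ[ℚ] L) (hcen : ∀ g : L ≃ₐ[ℚ] L, c * g = g * c) (hc2 : c * c = 1)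
    (hfix : ∀ φ : K →ₐ[ℚ] L, c • φ ≠ φ) (E : IntermediateField ℚ L) (hEK : E ≤ K)
    (hE : Module.finrank ℚ E = 2) : False := by
  classical
  have hX : Fintype.card (K →ₐ[ℚ] L) = 6 := by rw [card_emb K, hK]
  have hcard : Nat.card (L ≃ₐ[ℚ] L) = 24 ∨ Nat.card (L ≃ₐ[ℚ] L) = 48 := by
    rwa [IsGalois.card_aut_eq_finrank]
  refine no_index_two_above_stabilizer hX hcard c hcen hc2 hfix (φ₁ K) E.fixingSubgroup ?_ ?_
  · rw [stabilizer_val_eq_fixingSubgroup K]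
    intro g hg
    rw [IntermediateField.mem_fixingSubgroup_iff] at hg ⊢
    exact fun x hx => hg x (hEK hx)
  · have h1 : Nat.card E.fixingSubgroup = Module.finrank E L := by
      rw [← IsGalois.card_aut_eq_finrank E L]
      exact Nat.card_congr (IntermediateField.fixingSubgroupEquiv E).toEquiv
    have h2 : Module.finrank ℚ E * Module.finrank E L = Module.finrank ℚ L := Module.finrank_mul_finrank ℚ E L
    rw [h1, IsGalois.card_aut_eq_finrank, ← h2, hE]
    ring

/-- **"|H| = 4 resp. 8"** (PerL §1.2 l. 49): `|Gal(L/K)| = [L:K] = [L:ℚ]/6`. -/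
theorem card_gal_K [IsGalois ℚ L] (hK : Module.finrank ℚ K = 6)
    (hL : Module.finrank ℚ L = 24 ∨ Module.finrank ℚ L = 48) :
    Nat.card (L ≃ₐ[K] L) = 4 ∨ Nat.card (L ≃ₐ[K] L) = 8 := by
  have h2 : Module.finrank ℚ K * Module.finrank K L = Module.finrank ℚ L := Module.finrank_mul_finrank ℚ K L
  rw [IsGalois.card_aut_eq_finrank]
  rw [hK] at h2
  omega

end Field

/-! ### Embedded form: `K` ANY number field, base point an embedding `ψ₀ : K ↪ L` (PerL's `j`)

This is the form matching PerL's binders `(K L : CMField) (j : K →+* L)`: no inclusion `K ⊆ L` is presupposed.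
The `ℚ`-algebra structure on `K` is the canonical one of a characteristic-zero field (as for Mathlib number
fields and the package's bundled `CMField`s); the lemmas of this section are primed copies of the subfield ones. -/

section Emb

variable {L : Type*} [Field L] [NumberField L] (K : Type*) [Field K] [NumberField K]

/-- `Gal(L/ℚ)` acts on `Hom_ℚ(K, L)` by post-composition, for any number field `K`. -/
instance embMulAction' : MulAction (L ≃ₐ[ℚ] L) (K →ₐ[ℚ] L) where
  smul g φ := (g : L →ₐ[ℚ] L).comp φ
  one_smul φ := by ext k; rfl
  mul_smul g h φ := by ext k; rfl

/-- (Ported verbatim from the HodgeCMPerL package; no docstring in the source.) -/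
theorem emb_smul_apply' (g : L ≃ₐ[ℚ] L) (φ : K →ₐ[ℚ] L) (k : K) : (g • φ) k = g (φ k) := rfl

/-- (Ported verbatim from the HodgeCMPerL package; no docstring in the source.) -/
theorem emb_smul_coe' (g : L ≃ₐ[ℚ] L) (φ : K →ₐ[ℚ] L) :
    ((g • φ : K →ₐ[ℚ] L) : K →+* L) = (g : L →+* L).comp (φ : K →+* L) := rfl

/-- An automorphism of `L` composing trivially with every `ℚ`-embedding `K → L` is trivial, when `L` is a
normal closure of `K`. -/
theorem eq_one_of_comp_eq' [IsNormalClosure ℚ K L] (m : L ≃ₐ[ℚ] L) (hm : ∀ φ : K →ₐ[ℚ] L, m • φ = φ) :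
    m = 1 := by
  have htop : normalClosure ℚ K L = ⊤ :=
    ((Algebra.IsAlgebraic.isNormalClosure_iff).mp inferInstance).2
  have hle : normalClosure ℚ K L ≤ fixedField (Subgroup.zpowers m) := by
    rw [normalClosure_le_iff]
    intro φ x hx
    obtain ⟨k, rfl⟩ := AlgHom.mem_fieldRange.mp hx
    rw [mem_fixedField_iff]
    intro g hg
    obtain ⟨j, rfl⟩ := Subgroup.mem_zpowers_iff.mp hg
    have hfixk : φ k ∈ MulAction.fixedBy L m := by
      show m • φ k = φ k
      rw [AlgEquiv.smul_def, ← emb_smul_apply' K m φ k, hm φ]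
    have := MulAction.fixedBy_subset_fixedBy_zpow L m j hfixk
    simpa [AlgEquiv.smul_def] using this
  rw [htop, top_le_iff] at hle
  ext x
  have hx : x ∈ fixedField (Subgroup.zpowers m) := by rw [hle]; exact mem_top
  rw [mem_fixedField_iff] at hx
  exact hx m (Subgroup.mem_zpowers m)

/-- FAITHFULNESS of `Gal(L/ℚ)` on `Hom_ℚ(K, L)` (embedded form). -/
instance emb_faithful' [IsNormalClosure ℚ K L] : FaithfulSMul (L ≃ₐ[ℚ] L) (K →ₐ[ℚ] L) where
  eq_of_smul_eq_smul {g₁ g₂} h := by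
    have key : g₂⁻¹ * g₁ = 1 := eq_one_of_comp_eq' K _ fun φ => by
      rw [mul_smul, h φ, ← mul_smul, inv_mul_cancel, one_smul]
    have := congrArg (g₂ * ·) key
    simpa [← mul_assoc] using this

/-- `|Hom_ℚ(K, L)| = [K:ℚ]` (embedded form). -/
theorem card_emb' [IsNormalClosure ℚ K L] : Fintype.card (K →ₐ[ℚ] L) = Module.finrank ℚ K :=
  AlgHom.card_of_splits ℚ K L (IsNormalClosure.splits (F := ℚ) (K := K) (L := L))

variable {K}

/-- `Stab_𝒢(ψ₀) = Gal(L/ψ₀K)` for any base embedding `ψ₀ : K → L`. -/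
theorem stabilizer_eq_fixingSubgroup (ψ₀ : K →ₐ[ℚ] L) :
    MulAction.stabilizer (L ≃ₐ[ℚ] L) ψ₀ = ψ₀.fieldRange.fixingSubgroup := by
  ext g
  rw [MulAction.mem_stabilizer_iff, IntermediateField.mem_fixingSubgroup_iff]
  constructor
  · intro h x hx
    obtain ⟨k, rfl⟩ := AlgHom.mem_fieldRange.mp hx
    exact AlgHom.congr_fun h k
  · intro h
    apply AlgHom.ext
    intro k
    exact h (ψ₀ k) (AlgHom.mem_fieldRange.mpr ⟨k, rfl⟩)

/-- **PerL Lemma 2.1(b), "`H' = H`", embedded form.**  `K` a number field with `[K:ℚ] = 6`, `L` (Galois,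
`[L:ℚ] ∈ {24,48}`) a normal closure of `K`, `ψ₀ : K ↪ L` (PerL's `j`), `c` a central involution of `Gal(L/ℚ)`
moving every embedding, `Φ ∋ ψ₀` a CM type read in `L` (`φ ∈ Φ ↔ c ∘ φ ∉ Φ`).  Then the right stabiliser of
`\widetilde Φ = {g : g ∘ ψ₀ ∈ Φ}` is `Gal(L/ψ₀K)`. -/
theorem rightStab_eq_fixingSubgroup_emb [IsGalois ℚ L] [IsNormalClosure ℚ K L]
    (hK : Module.finrank ℚ K = 6) (hL : Module.finrank ℚ L = 24 ∨ Module.finrank ℚ L = 48)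
    (c : L ≃ₐ[ℚ] L) (hcen : ∀ g : L ≃ₐ[ℚ] L, c * g = g * c) (hc2 : c * c = 1)
    (hfix : ∀ φ : K →ₐ[ℚ] L, c • φ ≠ φ)
    (Φ : Finset (K →ₐ[ℚ] L)) (hΦ : ∀ φ, φ ∈ Φ ↔ c • φ ∉ Φ) (ψ₀ : K →ₐ[ℚ] L) (h0 : ψ₀ ∈ Φ) :
    rightStab {g : L ≃ₐ[ℚ] L | g • ψ₀ ∈ Φ} = ψ₀.fieldRange.fixingSubgroup := by
  classical
  have hX : Fintype.card (K →ₐ[ℚ] L) = 6 := by rw [card_emb' K, hK]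
  have hcard : Nat.card (L ≃ₐ[ℚ] L) = 24 ∨ Nat.card (L ≃ₐ[ℚ] L) = 48 := by
    rwa [IsGalois.card_aut_eq_finrank]
  rw [← stabilizer_eq_fixingSubgroup ψ₀]
  exact rightStab_pullback_eq_stabilizer hX hcard c hcen hc2 hfix Φ hΦ _ h0

/-- **No quadratic subfield**, embedded form: no `E ⊆ ψ₀K` with `[E:ℚ] = 2`. -/
theorem no_quadratic_subfield_emb [IsGalois ℚ L] [IsNormalClosure ℚ K L]
    (hK : Module.finrank ℚ K = 6) (hL : Module.finrank ℚ L = 24 ∨ Module.finrank ℚ L = 48)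
    (c : L ≃ₐ[ℚ] L) (hcen : ∀ g : L ≃ₐ[ℚ] L, c * g = g * c) (hc2 : c * c = 1)
    (hfix : ∀ φ : K →ₐ[ℚ] L, c • φ ≠ φ) (ψ₀ : K →ₐ[ℚ] L) (E : IntermediateField ℚ L)
    (hEK : E ≤ ψ₀.fieldRange) (hE : Module.finrank ℚ E = 2) : False := by
  classical
  have hX : Fintype.card (K →ₐ[ℚ] L) = 6 := by rw [card_emb' K, hK]
  have hcard : Nat.card (L ≃ₐ[ℚ] L) = 24 ∨ Nat.card (L ≃ₐ[ℚ] L) = 48 := by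
    rwa [IsGalois.card_aut_eq_finrank]
  refine no_index_two_above_stabilizer hX hcard c hcen hc2 hfix ψ₀ E.fixingSubgroup ?_ ?_
  · rw [stabilizer_eq_fixingSubgroup ψ₀]
    intro g hg
    rw [IntermediateField.mem_fixingSubgroup_iff] at hg ⊢
    exact fun x hx => hg x (hEK hx)
  · have h1 : Nat.card E.fixingSubgroup = Module.finrank E L := by
      rw [← IsGalois.card_aut_eq_finrank E L]
      exact Nat.card_congr (IntermediateField.fixingSubgroupEquiv E).toEquiv
    have h2 : Module.finrank ℚ E * Module.finrank E L = Module.finrank ℚ L := Module.finrank_mul_finrank ℚ E L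
    rw [h1, IsGalois.card_aut_eq_finrank, ← h2, hE]
    ring

/-- `|Gal(L/ψ₀K)| = [L:ℚ]/6 ∈ {4, 8}` (embedded form of PerL §1.2 l. 49 "|H| = 4 resp. 8"). -/
theorem card_fixingSubgroup_emb [IsGalois ℚ L] [IsNormalClosure ℚ K L]
    (hK : Module.finrank ℚ K = 6) (hL : Module.finrank ℚ L = 24 ∨ Module.finrank ℚ L = 48)
    (ψ₀ : K →ₐ[ℚ] L) :
    Nat.card ψ₀.fieldRange.fixingSubgroup = 4 ∨ Nat.card ψ₀.fieldRange.fixingSubgroup = 8 := by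
  classical
  have hX : Fintype.card (K →ₐ[ℚ] L) = 6 := by rw [card_emb' K, hK]
  have hcard : Nat.card (L ≃ₐ[ℚ] L) = 24 ∨ Nat.card (L ≃ₐ[ℚ] L) = 48 := by
    rwa [IsGalois.card_aut_eq_finrank]
  have h1 : Nat.card ψ₀.fieldRange.fixingSubgroup = Module.finrank ψ₀.fieldRange L := by
    rw [← IsGalois.card_aut_eq_finrank ψ₀.fieldRange L]
    exact Nat.card_congr (IntermediateField.fixingSubgroupEquiv ψ₀.fieldRange).toEquiv
  have h2 : Module.finrank ℚ ψ₀.fieldRange * Module.finrank ψ₀.fieldRange L = Module.finrank ℚ L :=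
    Module.finrank_mul_finrank ℚ ψ₀.fieldRange L
  have h3 : Module.finrank ℚ ψ₀.fieldRange = 6 := by
    rw [← hK]
    exact ((AlgEquiv.ofInjectiveField ψ₀).toLinearEquiv.finrank_eq).symm
  rw [h1]
  rw [h3] at h2
  omega

end Emb

/-! ### `c` = complex conjugation of a CM field: the three hypotheses on `c` are theorems -/

section CM

open NumberField

variable {L : Type*} [Field L] [NumberField L] [IsCMField L] (K : IntermediateField ℚ L)

/-- Complex conjugation of the CM field `L`, as an element of `Gal(L/ℚ)` (Mathlib's
`NumberField.IsCMField.complexConj`, which induces complex conjugation under EVERY embedding `L → ℂ`). -/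
noncomputable def conjL : L ≃ₐ[ℚ] L := (IsCMField.complexConj L).restrictScalars ℚ

/-- (Ported verbatim from the HodgeCMPerL package; no docstring in the source.) -/
theorem conjL_apply (x : L) : (conjL : L ≃ₐ[ℚ] L) x = IsCMField.complexConj L x := rfl

/-- `c² = 1`. -/
theorem conjL_mul_conjL : (conjL : L ≃ₐ[ℚ] L) * conjL = 1 := by
  ext x
  rw [AlgEquiv.mul_apply, conjL_apply, conjL_apply, IsCMField.complexConj_apply_apply, AlgEquiv.one_apply]

/-- **PerL l. 47 "complex conjugation `c ∈ 𝒢` is central"** — a theorem for CM fields. -/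
theorem conjL_central (g : L ≃ₐ[ℚ] L) : (conjL : L ≃ₐ[ℚ] L) * g = g * conjL := by
  obtain ⟨ψ⟩ : Nonempty (L →+* ℂ) := inferInstance
  ext x
  rw [AlgEquiv.mul_apply, AlgEquiv.mul_apply, conjL_apply, conjL_apply]
  apply ψ.injective
  have h1 := IsCMField.complexEmbedding_complexConj L ψ (g x)
  have h2 := IsCMField.complexEmbedding_complexConj L (ψ.comp (g : L →+* L)) x
  simp only [RingHom.coe_comp, Function.comp_apply] at h2
  rw [h1]
  exact h2.symm

/-- `c` moves every embedding of a totally imaginary subfield `K` (e.g. a CM subfield): `c ∘ φ ≠ φ`. -/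
theorem conjL_smul_ne [IsTotallyComplex K] (φ : K →ₐ[ℚ] L) : (conjL : L ≃ₐ[ℚ] L) • φ ≠ φ := by
  intro h
  obtain ⟨ψ⟩ : Nonempty (L →+* ℂ) := inferInstance
  have hreal : ComplexEmbedding.IsReal (ψ.comp (φ : K →+* L)) := by
    rw [ComplexEmbedding.isReal_iff]
    ext k
    have hk : IsCMField.complexConj L (φ k) = φ k := by
      have := AlgHom.congr_fun h k
      rwa [emb_smul_apply] at this
    have hmem : φ k ∈ maximalRealSubfield L := (IsCMField.complexConj_eq_self_iff L (φ k)).mp hk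
    have hstar := (mem_maximalRealSubfield_iff (φ k)).mp hmem ψ
    rw [ComplexEmbedding.conjugate_coe_eq, RingHom.coe_comp, Function.comp_apply]
    rw [RCLike.star_def] at hstar
    exact hstar
  exact IsTotallyComplex.complexEmbedding_not_isReal _ hreal

omit [IsCMField L] in
/-- The Galois closure of `K` is Galois over `ℚ`. -/
theorem isGalois_of_isNormalClosure [IsNormalClosure ℚ K L] : IsGalois ℚ L := by
  haveI : Normal ℚ L := IsNormalClosure.normal (F := ℚ) (K := K) (L := L)
  exact ⟨⟩

/-- **PerL Lemma 2.1(b) "`H' = H`", final form: everything about `c` derived.**  `L` a CM field that is the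
normal closure of its totally imaginary subfield `K` with `[K:ℚ] = 6`, `[L:ℚ] ∈ {24,48}`; `Φ ∋ φ₁` a CM type
(`φ ∈ Φ ↔ \bar φ ∉ Φ`, `\bar φ := c ∘ φ`).  Then the right stabiliser of `\widetilde Φ` is `Gal(L/K)`. -/
theorem rightStab_eq_gal [IsNormalClosure ℚ K L] [IsTotallyComplex K]
    (hK : Module.finrank ℚ K = 6) (hL : Module.finrank ℚ L = 24 ∨ Module.finrank ℚ L = 48)
    (Φ : Finset (K →ₐ[ℚ] L)) (hΦ : ∀ φ, φ ∈ Φ ↔ (conjL : L ≃ₐ[ℚ] L) • φ ∉ Φ) (h0 : φ₁ K ∈ Φ) :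
    rightStab {g : L ≃ₐ[ℚ] L | g • φ₁ K ∈ Φ} = K.fixingSubgroup := by
  haveI := isGalois_of_isNormalClosure K
  exact rightStab_eq_fixingSubgroup K hK hL conjL conjL_central conjL_mul_conjL (conjL_smul_ne K) Φ hΦ h0

/-- **PerL §1.2 l. 49 "`K` contains no imaginary quadratic field"**, final form. -/
theorem no_quadratic_subfield' [IsNormalClosure ℚ K L] [IsTotallyComplex K]
    (hK : Module.finrank ℚ K = 6) (hL : Module.finrank ℚ L = 24 ∨ Module.finrank ℚ L = 48)
    (E : IntermediateField ℚ L) (hEK : E ≤ K) (hE : Module.finrank ℚ E = 2) : False := by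
  haveI := isGalois_of_isNormalClosure K
  exact no_quadratic_subfield K hK hL conjL conjL_central conjL_mul_conjL (conjL_smul_ne K) E hEK hE


-- port_pkg: scope closed for this part
end CM
end GaloisB3
end PerL34
end HodgeCM
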